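import Mathlib
import Summits.ResolutionOfSingularities.ResolutionOfSingularities.Theorems.WeightedInvariantLocalWeightedDropNCResRegimeDefs
import Summits.ResolutionOfSingularities.ResolutionOfSingularities.Theorems.WeightedInvariantLocalWeightedDropNCResPhaseAssemblyEnd

/-!
# `LocalWeightedDrop`, TOT2-LINE inner S-ASM (2): THE `o ≥ 2` HEAD PHASE FROM ITS FOUR REGIME THEOREMS, and the registered stub's text from them

Crux item stmt-ResolutionOfSingularities-8899 `WeightedInvariant.LocalWeightedDrop` (route `ResolutionOfSingularities/WeightedInvariant`), ENGINE
skeleton v32 (ddb48572591139d5), registered residual `stub_spaceNCRankDrop`; TOT2-LINE v1.3 (res-L1-w43-lead-1 g5).  [OURS · L1 W4.3 · chain w43 ·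
seat res-L1-w43-lead-1 gen 5; def-free game bookkeeping over res-L1-w43-stub-1's S-SET / S-ASM OUTER (`highPhase_of_step`,
`…NCResPhaseAssemblyEnd.spaceNCRankDrop_of_highPhase`, R8 discharged by res-D-pv-006) and the regime vocabulary of part (1)
(`Decoration.HCol / GoodDir / BadDir / LetterDir`, `Decoration.regime_split`); the count game is the programme's own; NOT a statement of any
manuscript; AI-produced, gate-checked, weaker than expert review.]

THE FOUR REGIME THEOREMS (hypotheses here; the registered stubs of skeleton v33), all on product states `(b, δ)` read through `Prod.fst`, from an
admissible state with `2 ≤ o`, in three letters: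
* (H) APEX COLUMN `HCol δ` (`e^O ≤ 1`) ⇒ the mover forces an admissible state of SMALLER HEAD (res-type-056's isolated/apex-free theorems,
  res-L1-w43-stub-1's curve move with a letter-preserving witness, and the point-move loop on a non-normal-crossing equimultiple curve);
* (P) PRESENTED `¬ HCol δ`, `O ≠ ∅` or good position ⇒ smaller head, or the same head inside the apex column (the polyhedron play Σ**_d with the
  boundary: S-E2′, the δ-adapter, S-CRV);
* (L) LETTER DIRECTRIX `LetterDir δ l` ⇒ smaller head, or the same head in the apex column / good / bad position (the play on `f · x_l`);
* (B) BAD POSITION `BadDir δ` ⇒ smaller head, or the same head in the apex column / good position (the `e^S ≤ 1` device on `f · ∏_{l ∈ supp ℓ} x_l`).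
* `highPhase_of_regimes` — (H)+(P)+(L)+(B) ⇒ `hhigh` (`highPhase_of_step` with the secondary measure «regime rank» `HCol ↦ 0`, presented `↦ 1`,
  bad `↦ 2`, letter `↦ 3`; `Decoration.regime_split` says rank `3` is the letter regime);
* **`spaceNCRankDrop_of_regimes`** — the registered stub's TEXT (`stub_spaceNCRankDrop`, `m + 1 = 3`, binders `∀ p prime, ∀ k, [Field k] [CharP k p]
  [IsAlgClosed k]`) from the four regime theorems under the same binders (`spaceNCRankDrop_of_highPhase`).
-/

set_option linter.dupNamespace false -- mandated namespace of this single-conjunct summit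

noncomputable section

namespace Summit.ResolutionOfSingularities.ResolutionOfSingularities.Theorems

namespace TameFourTupleDrop

open MvPowerSeries Literature.AlgebraicGeometry.Resolution

variable {k : Type} [Field k]

/-- **THE `o ≥ 2` HEAD PHASE FROM THE FOUR REGIME THEOREMS** (three letters, any field with infinitely many elements). -/
theorem highPhase_of_regimes [Infinite k]
    (hH : ∀ (b : MvPowerSeries (Fin (2 + 1)) k) (δ : Decoration k 2), Admissible b δ → 2 ≤ δ.o → δ.HCol →
      DWinsTo (St := MvPowerSeries (Fin (2 + 1)) k × Decoration k 2) Prod.fst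
        (fun τ => Admissible τ.1 τ.2 ∧ τ.2.head < δ.head) (b, δ))
    (hP : ∀ (b : MvPowerSeries (Fin (2 + 1)) k) (δ : Decoration k 2), Admissible b δ → 2 ≤ δ.o → ¬ δ.HCol →
      (δ.O.Nonempty ∨ δ.GoodDir) →
      DWinsTo (St := MvPowerSeries (Fin (2 + 1)) k × Decoration k 2) Prod.fst
        (fun τ => Admissible τ.1 τ.2 ∧ (τ.2.head < δ.head ∨ (τ.2.head = δ.head ∧ τ.2.HCol))) (b, δ))
    (hL : ∀ (b : MvPowerSeries (Fin (2 + 1)) k) (δ : Decoration k 2) (l : Fin (2 + 1)), Admissible b δ → 2 ≤ δ.o → ¬ δ.HCol →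
      δ.LetterDir l →
      DWinsTo (St := MvPowerSeries (Fin (2 + 1)) k × Decoration k 2) Prod.fst
        (fun τ => Admissible τ.1 τ.2 ∧ (τ.2.head < δ.head ∨ (τ.2.head = δ.head ∧ (τ.2.HCol ∨ τ.2.GoodDir ∨ τ.2.BadDir)))) (b, δ))
    (hB : ∀ (b : MvPowerSeries (Fin (2 + 1)) k) (δ : Decoration k 2), Admissible b δ → 2 ≤ δ.o → ¬ δ.HCol → δ.BadDir →
      DWinsTo (St := MvPowerSeries (Fin (2 + 1)) k × Decoration k 2) Prod.fst
        (fun τ => Admissible τ.1 τ.2 ∧ (τ.2.head < δ.head ∨ (τ.2.head = δ.head ∧ (τ.2.HCol ∨ τ.2.GoodDir)))) (b, δ))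
    (b : MvPowerSeries (Fin (2 + 1)) k) (δ : Decoration k 2) (hadm : Admissible b δ) (ho : 2 ≤ δ.o) :
    DWinsTo (St := MvPowerSeries (Fin (2 + 1)) k × Decoration k 2) Prod.fst
      (fun τ => Admissible τ.1 τ.2 ∧ τ.2.head < δ.head) (b, δ) := by
  classical
  -- the regime rank: apex column 0, presented 1, bad position 2, letter directrix 3
  let rk : Decoration k 2 → ℕ := fun ε =>
    if ε.HCol then 0 else if ε.O.Nonempty ∨ ε.GoodDir then 1 else if ε.BadDir then 2 else 3
  have rk_hcol : ∀ ε : Decoration k 2, ε.HCol → rk ε = 0 := fun ε h => by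
    simp only [rk, if_pos h]
  have rk_good : ∀ ε : Decoration k 2, ε.GoodDir → rk ε ≤ 1 := fun ε h => by
    simp only [rk]
    split_ifs <;> simp_all
  have rk_bad : ∀ ε : Decoration k 2, ε.BadDir → rk ε ≤ 2 := fun ε h => by
    simp only [rk]
    split_ifs <;> simp_all
  refine highPhase_of_step (α := ℕ) (fun τ => rk τ.2) (fun b' δ' hadm' ho' => ?_) b δ hadm ho
  by_cases hc : δ'.HCol
  · exact (hH b' δ' hadm' ho' hc).mono fun τ hτ => ⟨hτ.1, Or.inl hτ.2⟩
  by_cases hp : δ'.O.Nonempty ∨ δ'.GoodDir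
  · have hrk : rk δ' = 1 := by simp only [rk, if_neg hc, if_pos hp]
    refine (hP b' δ' hadm' ho' hc hp).mono fun τ hτ => ⟨hτ.1, hτ.2.imp_right fun h => ⟨h.1, ?_⟩⟩
    change rk τ.2 < rk δ'
    rw [hrk, rk_hcol τ.2 h.2]
    exact zero_lt_one
  by_cases hb : δ'.BadDir
  · have hrk : rk δ' = 2 := by simp only [rk, if_neg hc, if_neg hp, if_pos hb]
    refine (hB b' δ' hadm' ho' hc hb).mono fun τ hτ => ⟨hτ.1, hτ.2.imp_right fun h => ⟨h.1, ?_⟩⟩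
    change rk τ.2 < rk δ'
    rw [hrk]
    rcases h.2 with h0 | h1
    · rw [rk_hcol τ.2 h0]; exact zero_lt_two
    · exact lt_of_le_of_lt (rk_good τ.2 h1) one_lt_two
  · have hrk : rk δ' = 3 := by simp only [rk, if_neg hc, if_neg hp, if_neg hb]
    obtain ⟨l, hl⟩ : ∃ l, δ'.LetterDir l := by
      rcases Decoration.regime_split hadm' ho' hc with h | h | h | h
      · exact absurd (Or.inl h) hp
      · exact absurd (Or.inr h) hp
      · exact absurd h hb
      · exact h
    refine (hL b' δ' l hadm' ho' hc hl).mono fun τ hτ => ⟨hτ.1, hτ.2.imp_right fun h => ⟨h.1, ?_⟩⟩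
    change rk τ.2 < rk δ'
    rw [hrk]
    rcases h.2 with h0 | h1 | h2
    · rw [rk_hcol τ.2 h0]; exact zero_lt_three
    · exact lt_of_le_of_lt (rk_good τ.2 h1) (by norm_num)
    · exact lt_of_le_of_lt (rk_bad τ.2 h2) (by norm_num)

/-- **THE REGISTERED STUB'S TEXT (`stub_spaceNCRankDrop`, skeleton v32, `m + 1 = 3`) FROM THE FOUR REGIME THEOREMS**, each taken under the stub's
own binders `∀ p prime, ∀ k, [Field k] [CharP k p] [IsAlgClosed k]` (the endgame `o ≤ 1` is R8, discharged in `…NCResPhaseAssemblyEnd`). -/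
theorem spaceNCRankDrop_of_regimes
    (hH : ∀ (p : ℕ), p.Prime → ∀ (k : Type) [Field k] [CharP k p] [IsAlgClosed k],
      ∀ (b : MvPowerSeries (Fin 3) k) (δ : Decoration k 2), Admissible b δ → 2 ≤ δ.o → δ.HCol →
        DWinsTo (St := MvPowerSeries (Fin 3) k × Decoration k 2) Prod.fst
          (fun τ => Admissible τ.1 τ.2 ∧ τ.2.head < δ.head) (b, δ))
    (hP : ∀ (p : ℕ), p.Prime → ∀ (k : Type) [Field k] [CharP k p] [IsAlgClosed k],
      ∀ (b : MvPowerSeries (Fin 3) k) (δ : Decoration k 2), Admissible b δ → 2 ≤ δ.o → ¬ δ.HCol → (δ.O.Nonempty ∨ δ.GoodDir) →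
        DWinsTo (St := MvPowerSeries (Fin 3) k × Decoration k 2) Prod.fst
          (fun τ => Admissible τ.1 τ.2 ∧ (τ.2.head < δ.head ∨ (τ.2.head = δ.head ∧ τ.2.HCol))) (b, δ))
    (hL : ∀ (p : ℕ), p.Prime → ∀ (k : Type) [Field k] [CharP k p] [IsAlgClosed k],
      ∀ (b : MvPowerSeries (Fin 3) k) (δ : Decoration k 2) (l : Fin 3), Admissible b δ → 2 ≤ δ.o → ¬ δ.HCol → δ.LetterDir l →
        DWinsTo (St := MvPowerSeries (Fin 3) k × Decoration k 2) Prod.fst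
          (fun τ => Admissible τ.1 τ.2 ∧ (τ.2.head < δ.head ∨ (τ.2.head = δ.head ∧ (τ.2.HCol ∨ τ.2.GoodDir ∨ τ.2.BadDir)))) (b, δ))
    (hB : ∀ (p : ℕ), p.Prime → ∀ (k : Type) [Field k] [CharP k p] [IsAlgClosed k],
      ∀ (b : MvPowerSeries (Fin 3) k) (δ : Decoration k 2), Admissible b δ → 2 ≤ δ.o → ¬ δ.HCol → δ.BadDir →
        DWinsTo (St := MvPowerSeries (Fin 3) k × Decoration k 2) Prod.fst
          (fun τ => Admissible τ.1 τ.2 ∧ (τ.2.head < δ.head ∨ (τ.2.head = δ.head ∧ (τ.2.HCol ∨ τ.2.GoodDir)))) (b, δ)) :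
    ∀ (p : ℕ), p.Prime → ∀ (k : Type) [Field k] [CharP k p] [IsAlgClosed k],
      ∃ ρ : MvPowerSeries (Fin 3) k → Ordinal.{0}, ∀ b : MvPowerSeries (Fin 3) k, b ≠ 0 → ¬ GermIsNC b →
        ∃ (Φ : Fin 3 → MvPowerSeries (Fin 3) k) (w : Fin 3 → ℕ),
          IsCountMove (m := 2) Φ w ∧ MoveClause (m := 2) b Φ w (fun b' => ρ b' < ρ b) :=
  spaceNCRankDrop_of_highPhase fun p hp k _ _ _ b δ hadm ho =>
    highPhase_of_regimes (hH p hp k) (hP p hp k) (hL p hp k) (hB p hp k) b δ hadm ho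

end TameFourTupleDrop

end Summit.ResolutionOfSingularities.ResolutionOfSingularities.Theorems

end
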